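import Summits.ValiantsHypothesis.ValiantsHypothesis.Theses.DivisionGap
import Summits.ValiantsHypothesis.ValiantsHypothesis.Theorems.DivisionGapShadowCofactorSplit
import Summits.ValiantsHypothesis.ValiantsHypothesis.Theorems.DivisionGapPerMultiplesToDivision

/-!
# Crux-strategist sketch — crux `stmt-ValiantsHypothesis-5065` (`DivisionGap.PerDivisionHard`)

Typed companions of `STRATEGY-CENSUS.md` (planner-cstrat-stmt-ValiantsHypothesis-5065-s1-0,
2026-08-17).  Everything here is sorry-free; nothing is a new route item.  The point of the file is
that the census's STRENGTHEN and DECOMPOSITION entries are stated over existing declarations and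
that the claimed implications are kernel-checked:

* `LowDegreePerMultiplesHard` — the low-degree (= formula-strength) piece of the degree split (D1);
* `lowDegreeSplit` — D1's glue `LowDegreePerMultiplesHard → PerCofactorDegreeReduction →
  PerMultiplesHard` (hence `→ PerDivisionHard`, `lowDegreeSplit_division`);
* `lowDegree_of_shadowBirkhoff` — the low-degree piece is implied by the EXISTING crux
  `ShadowBirkhoff` through the landed HY21 Thm 42 (`ncard_extremePoints_le_of_multiple`) and
  Brent/VSBR balancing (`formulaComplexity_le_two_pow`): so D1 adds no attack surface beyond the
  items already on the route (`ShadowBirkhoff`, `PerCofactorDegreeReduction`, `ShadowCofactorSplit`);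
* `SetCrux`, `setCrux_imp` — the support-level strengthening S3 (dossier v7 §5 "set crux");
* `ApproxPairHard`, `approxPairHard_imp` — the pointwise-approximation strengthening S4 (the
  family interpolating between the crux, `K = 1`, and the tropical `(min,+,−)` statement,
  `K = 2^{poly}`).
-/

noncomputable section

set_option linter.dupNamespace false

namespace Summit.ValiantsHypothesis.ValiantsHypothesis.Cruxes.PerDivisionHard.Strategist

open MvPolynomial Literature.Computability.AlgebraicComplexity
open Summit.ValiantsHypothesis.ValiantsHypothesis.Theses.DivisionGap
open Summit.ValiantsHypothesis.ValiantsHypothesis.Theorems.DivisionGap.ShadowCofactorSplit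
  (ncard_extremePoints_le_of_multiple exists_exponent)
open scoped NNReal

/-! ### D1 — the degree split, piece 1: low-degree (formula-strength) multiples -/

/-- **LowDegreePerMultiplesHard** (D1, piece 1): every nonzero monotone multiple `per_n · h` with
`deg h ≤ 2^{(log₂ n + c)^c}` needs monotone circuits of size `> 2^{(log₂ n + c)^c}` for large `n`.
Equivalent up to quasi-polynomial reparametrisation to "monotone FORMULAS for nonzero multiples of
`per_n` are super-quasi-polynomial" (balancing one way, `deg ≤ size` the other). -/
def LowDegreePerMultiplesHard : Prop :=
  ∀ c : ℕ, ∃ n₀ : ℕ, ∀ n ≥ n₀, ∀ h : MvPolynomial (Fin n × Fin n) ℝ≥0, h ≠ 0 →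
    h.totalDegree ≤ 2 ^ ((Nat.log 2 n + c) ^ c) →
    2 ^ ((Nat.log 2 n + c) ^ c) < complexity (perPoly (Fin n) ℝ≥0 * h)

/-- Exponent bookkeeping for D1: `(ℓ + (ℓ + c)^c + k)^k ≤ (ℓ + c₂)^{c₂}`. [folklore] -/
theorem exists_exponent' (c k : ℕ) : ∃ c₂ : ℕ, ∀ ℓ : ℕ,
    (ℓ + (ℓ + c) ^ c + k) ^ k ≤ (ℓ + c₂) ^ c₂ := by
  obtain ⟨c₂, hc₂⟩ := exists_exponent c k
  refine ⟨c₂, fun ℓ => le_trans ?_ (hc₂ ℓ)⟩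
  set E := (ℓ + (ℓ + c) ^ c + k) ^ k
  nlinarith [Nat.zero_le E, Nat.zero_le ℓ]

/-- **D1 glue (kernel-checked):** `LowDegreePerMultiplesHard → PerCofactorDegreeReduction →
PerMultiplesHard`.  If `PerMultiplesHard` fails at exponent `c`, degree reduction (exponent `k`)
turns the cheap multiple into a cheap multiple of quasi-polynomial degree, which the low-degree
piece forbids at exponent `c₂(c,k)`. -/
theorem lowDegreeSplit :
    LowDegreePerMultiplesHard → PerCofactorDegreeReduction → PerMultiplesHard := by
  unfold LowDegreePerMultiplesHard PerCofactorDegreeReduction PerMultiplesHard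
  intro hLD hDR
  by_contra hPMH
  push Not at hPMH
  obtain ⟨c, hc⟩ := hPMH
  obtain ⟨k, hk⟩ := hDR
  obtain ⟨c₂, hc₂⟩ := exists_exponent' c k
  obtain ⟨n₀, hn₀⟩ := hLD c₂
  obtain ⟨n, hn, h, hh, hs⟩ := hc n₀
  obtain ⟨h', hh', hdeg, hcomp⟩ := hk n h hh
  set s := complexity (perPoly (Fin n) ℝ≥0 * h) with hs_def
  set ℓ := Nat.log 2 n with hℓ
  set A := (ℓ + c) ^ c with hA
  have hlog : Nat.log 2 s ≤ A :=
    calc Nat.log 2 s ≤ Nat.log 2 (2 ^ A) := Nat.log_mono_right hs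
      _ = A := Nat.log_pow Nat.one_lt_two A
  have hE : (ℓ + Nat.log 2 s + k) ^ k ≤ (ℓ + c₂) ^ c₂ :=
    le_trans (Nat.pow_le_pow_left (by omega) k) (hc₂ ℓ)
  have hdeg' : h'.totalDegree ≤ 2 ^ ((ℓ + c₂) ^ c₂) :=
    hdeg.trans (Nat.pow_le_pow_right Nat.two_pos hE)
  have hlt := hn₀ n hn h' hh' hdeg'
  have hle : complexity (perPoly (Fin n) ℝ≥0 * h') ≤ 2 ^ ((ℓ + c₂) ^ c₂) :=
    hcomp.trans (Nat.pow_le_pow_right Nat.two_pos hE)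
  exact absurd hlt (not_lt.2 hle)

/-- D1 glue down to the crux: `LowDegreePerMultiplesHard → PerCofactorDegreeReduction →
PerDivisionHard` (through the proved support item `PerMultiplesToDivision`). -/
theorem lowDegreeSplit_division :
    LowDegreePerMultiplesHard → PerCofactorDegreeReduction → PerDivisionHard :=
  fun hLD hDR =>
    Summit.ValiantsHypothesis.ValiantsHypothesis.Theorems.perMultiplesToDivision_proof
      (lowDegreeSplit hLD hDR)

/-- **Piece 1 is already implied by the route's crux `ShadowBirkhoff`** (landed engine:
HY21 Thm 42 for the tree's formula model + balancing).  So the degree split of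
`PerDivisionHard` is, on the ledger, exactly `{ShadowBirkhoff, PerCofactorDegreeReduction}` —
both existing, both staffed. -/
theorem lowDegree_of_shadowBirkhoff : ShadowBirkhoff → LowDegreePerMultiplesHard := by
  unfold ShadowBirkhoff LowDegreePerMultiplesHard
  intro hSB c
  -- exponent: with E = A + 2ℓ + 3 ≤ (ℓ + A + 1)^1 + 2ℓ + 3 we use `exists_exponent c 1`
  obtain ⟨c₂, hc₂⟩ := exists_exponent c 1
  obtain ⟨n₀, hn₀⟩ := hSB c₂
  refine ⟨n₀, fun n hn h hh hdeg => ?_⟩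
  by_contra hs
  push Not at hs
  obtain ⟨L, hL⟩ := hn₀ n hn
  set ℓ := Nat.log 2 n with hℓ
  set A := (ℓ + c) ^ c with hA
  set E := A + 2 * ℓ + 3 with hE
  have h2E : 2 ^ E = 2 ^ A * 2 ^ (ℓ + 1) * 2 ^ (ℓ + 1) * 2 := by
    rw [hE, show A + 2 * ℓ + 3 = A + (ℓ + 1) + (ℓ + 1) + 1 by omega, pow_add, pow_add, pow_add,
      pow_one]
  have hnlt : n < 2 ^ (ℓ + 1) := Nat.lt_pow_succ_log_self Nat.one_lt_two n
  have ha1 : 1 ≤ 2 ^ A := Nat.one_le_two_pow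
  have hb1 : 1 ≤ 2 ^ (ℓ + 1) := Nat.one_le_two_pow
  have hd : n + 2 ^ A < 2 ^ E := by
    rw [h2E]
    have h1 : n + 2 ^ A < 2 ^ (ℓ + 1) + 2 ^ A := by omega
    have h2 : 2 ^ (ℓ + 1) ≤ 2 ^ A * 2 ^ (ℓ + 1) * 2 ^ (ℓ + 1) :=
      calc 2 ^ (ℓ + 1) = 1 * 2 ^ (ℓ + 1) * 1 := by ring
        _ ≤ 2 ^ A * 2 ^ (ℓ + 1) * 2 ^ (ℓ + 1) :=
          Nat.mul_le_mul (Nat.mul_le_mul_right _ ha1) hb1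
    have h3 : 2 ^ A ≤ 2 ^ A * 2 ^ (ℓ + 1) * 2 ^ (ℓ + 1) :=
      calc 2 ^ A = 2 ^ A * 1 * 1 := by ring
        _ ≤ 2 ^ A * 2 ^ (ℓ + 1) * 2 ^ (ℓ + 1) :=
          Nat.mul_le_mul (Nat.mul_le_mul_left _ hb1) hb1
    omega
  have hcard : Fintype.card (Fin n × Fin n) ≤ 2 ^ E := by
    rw [Fintype.card_prod, Fintype.card_fin, h2E]
    calc n * n ≤ 2 ^ (ℓ + 1) * 2 ^ (ℓ + 1) := Nat.mul_le_mul hnlt.le hnlt.le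
      _ = 1 * 2 ^ (ℓ + 1) * 2 ^ (ℓ + 1) * 1 := by ring
      _ ≤ 2 ^ A * 2 ^ (ℓ + 1) * 2 ^ (ℓ + 1) * 2 :=
          Nat.mul_le_mul (Nat.mul_le_mul_right _ (Nat.mul_le_mul_right _ ha1)) (by norm_num)
  have hper : (perPoly (Fin n) ℝ≥0).totalDegree ≤ n := by
    simpa using (perPoly_isHomogeneous (n := Fin n) (k := ℝ≥0)).totalDegree_le
  have hdeg' : (perPoly (Fin n) ℝ≥0 * h).totalDegree ≤ n + 2 ^ A :=
    calc (perPoly (Fin n) ℝ≥0 * h).totalDegree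
        ≤ (perPoly (Fin n) ℝ≥0).totalDegree + h.totalDegree := totalDegree_mul _ _
      _ ≤ n + 2 ^ A := add_le_add hper hdeg
  have hL' : complexity (perPoly (Fin n) ℝ≥0 * h) ≤ 2 ^ E :=
    hs.trans (Nat.pow_le_pow_right Nat.two_pos (by omega))
  have hE1 : 1 ≤ E := by omega
  have hfc := formulaComplexity_le_two_pow hdeg' hd hcard hL' hE1
  have hV := ncard_extremePoints_le_of_multiple L h hh
  -- 18 E² + 4 ≤ (ℓ + c₂)^{c₂}: compare E with the E(ℓ) of `exists_exponent c 1`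
  have hEE : E ≤ (ℓ + (ℓ + c) ^ c + 1) ^ 1 + 2 * ℓ + 3 := by
    rw [pow_one]; omega
  have hexp : 18 * E ^ 2 + 4 ≤ (ℓ + c₂) ^ c₂ := by
    have h18 := hc₂ ℓ
    have hsq : E ^ 2 ≤ ((ℓ + (ℓ + c) ^ c + 1) ^ 1 + 2 * ℓ + 3) ^ 2 := Nat.pow_le_pow_left hEE 2
    omega
  have hfinal : (Set.extremePoints ℝ (convexHull ℝ (L '' permMatrixPoints n))).ncard ≤
      2 ^ ((ℓ + c₂) ^ c₂) :=
    calc (Set.extremePoints ℝ (convexHull ℝ (L '' permMatrixPoints n))).ncard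
        ≤ 4 * (3 * formulaComplexity (perPoly (Fin n) ℝ≥0 * h) + 1) := hV
      _ ≤ 4 * (3 * 2 ^ (18 * E ^ 2) + 1) :=
          Nat.mul_le_mul_left 4 (Nat.add_le_add_right (Nat.mul_le_mul_left 3 hfc) 1)
      _ ≤ 2 ^ (18 * E ^ 2 + 4) := by
          rw [pow_add]
          have h16 : (2 : ℕ) ^ 4 = 16 := by norm_num
          rw [h16]
          have := Nat.one_le_two_pow (n := 18 * E ^ 2)
          omega
      _ ≤ 2 ^ ((ℓ + c₂) ^ c₂) := Nat.pow_le_pow_right Nat.two_pos hexp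
  exact absurd hL (not_lt.2 hfinal)

/-! ### S3 — the SET CRUX (support-level strengthening; dossier v7 §5) -/

/-- **SetCrux**: hardness survives replacing `per_n · h` and `h` by ANY monotone polynomials with
the same supports (sumset-circuit complexity of the pair `(S_n + H, H)`).  Every landed rung of the
three planned lines is support-level, hence a proof of the corresponding instance of `SetCrux`;
a cheap sumset pair would kill all of them at once (barrier candidate T8). -/
def SetCrux : Prop :=
  ∀ c : ℕ, ∃ n₀ : ℕ, ∀ n ≥ n₀, ∀ h g h₂ : MvPolynomial (Fin n × Fin n) ℝ≥0, h ≠ 0 →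
    g.support = (perPoly (Fin n) ℝ≥0 * h).support → h₂.support = h.support →
    2 ^ ((Nat.log 2 n + c) ^ c) < complexity g + complexity h₂

/-- S3 is a strengthening: `SetCrux → PerDivisionHard` (take `g = per_n · h`, `h₂ = h`). -/
theorem setCrux_imp : SetCrux → PerDivisionHard := by
  unfold SetCrux PerDivisionHard
  intro hS c
  obtain ⟨n₀, hn₀⟩ := hS c
  exact ⟨n₀, fun n hn h hh => hn₀ n hn h _ _ hh rfl rfl⟩

/-! ### S4 — hardness of POINTWISE APPROXIMATION on the open orthant -/

/-- **ApproxPairHard K**: no quasi-polynomially cheap monotone pair `(g, h)` makes `g/h`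
approximate `per_n` within the factor `K n` at every point of the open positive orthant.
`K = 1` contains the crux (an exact pair approximates with factor 1).  Maslov dequantisation
(`x = e^{-y/t}`, `t → 0`; constants and the factor `K n` vanish) turns ANY cheap approximating pair
into an exact `(min,+,−)` circuit of the same size for the assignment problem, so
"assignment has no quasi-polynomial `(min,+,−)` circuit" (Jukna 2023 §6.5 Problem 3, which leans
the other way: Hungarian method) implies `ApproxPairHard K` for every `K`; conversely a
`(min,+,−)` circuit of size `s` and depth `d` requantises to a pair approximating `per_n` within
`n! · 2^{2^d}`, so `ApproxPairHard (2^{poly})` already forbids polynomial-size `O(log n)`-depth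
`(min,+,−)` circuits for assignment — a statement whose only known handle is Mulmuley's
parametric-complexity bound, i.e. `σ(DS_n)` = `ShadowBirkhoff` again (HY21 Rem. 32). -/
def ApproxPairHard (K : ℕ → ℕ) : Prop :=
  ∀ c : ℕ, ∃ n₀ : ℕ, ∀ n ≥ n₀, ∀ g h : MvPolynomial (Fin n × Fin n) ℝ≥0, h ≠ 0 →
    complexity g + complexity h ≤ 2 ^ ((Nat.log 2 n + c) ^ c) →
    ¬ (∀ x : Fin n × Fin n → ℝ≥0, (∀ e, 0 < x e) →
        eval x (perPoly (Fin n) ℝ≥0 * h) ≤ K n * eval x g ∧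
        eval x g ≤ K n * eval x (perPoly (Fin n) ℝ≥0 * h))

/-- S4 is a strengthening for every `K ≥ 1`: `ApproxPairHard K → PerDivisionHard`. -/
theorem approxPairHard_imp (K : ℕ → ℕ) (hK : ∀ n, 1 ≤ K n) : ApproxPairHard K → PerDivisionHard := by
  unfold ApproxPairHard PerDivisionHard
  intro hA c
  obtain ⟨n₀, hn₀⟩ := hA c
  refine ⟨n₀, fun n hn h hh => ?_⟩
  by_contra hlt
  push Not at hlt
  refine hn₀ n hn (perPoly (Fin n) ℝ≥0 * h) h hh hlt (fun x _ => ⟨?_, ?_⟩)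
  · calc eval x (perPoly (Fin n) ℝ≥0 * h) = 1 * eval x (perPoly (Fin n) ℝ≥0 * h) := (one_mul _).symm
      _ ≤ K n * eval x (perPoly (Fin n) ℝ≥0 * h) := by
          gcongr
          exact_mod_cast hK n
  · calc eval x (perPoly (Fin n) ℝ≥0 * h) = 1 * eval x (perPoly (Fin n) ℝ≥0 * h) := (one_mul _).symm
      _ ≤ K n * eval x (perPoly (Fin n) ℝ≥0 * h) := by
          gcongr
          exact_mod_cast hK n

end Summit.ValiantsHypothesis.ValiantsHypothesis.Cruxes.PerDivisionHard.Strategist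

end
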